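import Literature.NumberTheory.Automorphic.HyperspecialUnitarySatakeKlingenDescent
import Literature.NumberTheory.Automorphic.HyperspecialUnitarySatakeIntegralSymmetry
import Literature.NumberTheory.Automorphic.HyperspecialUnitarySatakeIsomorphismRankOne
import Literature.NumberTheory.Automorphic.HeckePairsValuedFiniteResidueField
import HarnessLib

/-!
# Weyl-group invariance of the Satake transform of the quasi-split unitary group `U(σ, J₀)` in every rank
# (Cartier 1979 §IV Thm. 4.1 (b); Satake 1963 §6; Mínguez 2011 §4)

Topic `NumberTheory/Automorphic`; namespace `Literature.NumberTheory.Automorphic.HermitianLattice[.UnramifiedLocalConjDatum]`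
(lane `lit-hodgefound`, Track 2 foundations; seat `lit-hodgefound-p11`, generation 48, row g48-#5).  One DEFINITION with body
(`swapPairZero`) + theorems; no named fact, no instance, no notation.

## The mathematics

Let `K ⊃ 𝒪 ∋ ϖ` carry an unramified conjugation datum `σ` (`UnramifiedLocalConjDatum`) with `σ ≠ id` and finite residue field of
`q = q_F²` elements, `G = U_N = U(σ, J₀^{(N)})`, `K₀ = G ∩ GL_N(𝒪)` (hyperspecial), `n = ⌊N/2⌋`.  The relative root system of `G` is of
type `C_n` (`N` even) or `BC_n` (`N` odd) and its Weyl group `W = (ℤ/2)^n ⋊ S_n` acts on the cocharacters `μ ∈ ℤ^N`,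
`μ ∘ rev = -μ`, of the diagonal torus through the permutations of the coordinates commuting with `rev : i ↦ N - 1 - i`
([BruhatTits1972] (4.4.3)); as a permutation group, `W = C_{S_N}(rev)`.  THEOREM (Satake; Cartier Thm. 4.1 (b)): for every
commutative ring `R` containing `q_F` as a unit `u`, the Satake transform
`𝒮_w(T) = ∑_μ (T[K₀] ↦ …) ∈ R[ℤ^N]`, `w(μ) = u^{-⟨ν, μ⟩} = δ_B^{1/2}(ϖ^μ)`, of every `T ∈ ℋ_R(G, K₀)` is `W`-invariant:
**`𝒮_w(T)_{μ ∘ π} = 𝒮_w(T)_μ` for every permutation `π` of `Fin N` commuting with `rev`.**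

PROOF (induction on `N`, step `2`).  `N ≤ 1`: `π = 1`.  `N = M + 2`: write `k = π(0)`.  (i) If `k = 0` then `π` fixes `0` and
`M + 1 = rev 0`, so `π = π̂'` extends a `rev`-commuting permutation `π'` of the middle block, and the KLINGEN DESCENT
(`HyperspecialUnitarySatakeKlingenDescent.coeff_satakeTransform_comp_klingenExtend`) reduces the claim to the `π'`-invariance of the
transforms `𝒮^{U_M}_{w ∘ κ₀}(T')`; as `w ∘ κ₀ = u^{-|·|} · w_M` with `w_M = u^{-⟨ν_M, ·⟩}` and `|λ ∘ π'| = |λ|`, this is the induction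
hypothesis for `U_M`.  (ii) If `0 < k < n`, the double transposition `t = (0 k)(M+1, rev k)` commutes with `rev` and preserves the
first block, so `𝒮_w(T)` is `t`-invariant by the SIEGEL DESCENT (`HyperspecialUnitarySatakeSiegelDescent.coeff_satakeTransform_comp_perm
_siegel`, which needs `u² = q`), and `t π` fixes `0`: case (i).  (iii) Otherwise `rev k < n` (`k` is not the middle index, which is
the only fixed point of `rev`, because `π` commutes with `rev` and `0 ≠ rev 0`), and `rev ∘ π` falls under (i)/(ii); finally
`𝒮_w(T)` is `rev`-invariant by the `w₀ = -1` symmetry `𝒮_w(T)_{-μ} = 𝒮_w(T)_μ`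
(`HyperspecialUnitarySatakeIntegralSymmetry.coeff_satakeTransform_neg_of_units_unitary`) and the support condition `μ ∘ rev = -μ`.

## What is formalised

* §1 `exists_klingenExtend_eq` (a `rev`-commuting permutation fixing `0` is `π̂'` for a `rev`-commuting `π'`), `swapPairZero`
  (`t = (0 k)(M+1, rev k)`), `swapPairZero_val`, `swapPairZero_apply_self`, `swapPairZero_rev`, `swapPairZero_lt_iff`,
  `perm_zero_lt_or_rev_lt`, inverse lemmas `perm_inv_rev`, `perm_inv_lt_iff`.
* §2 `satakeTwistExp_klingenExp_zero` / `satakeTwistExp_klingenMidHom` (`⟨ν_{M+2}, κ₀ λ⟩ = ⟨ν_M, λ⟩ + |λ|`),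
  `exists_monoidHom_klingenWeight` (the weight `u^{-(⟨ν,·⟩ + |·|)}` exists as a character; `u^{-⟨ν,·⟩}` is the tree's
  `exists_weight_units_zpow_neg_satakeTwistExp`), `comp_klingenMidHom_eq` (`w ∘ κ₀ = u^{-(⟨ν_M,·⟩ + |·|)}`), `coeff_satakeTransform_eq_weight_mul`,
  `coeff_satakeTransform_comp_rev_of_units_unitary` (`rev`-invariance in every rank).
* §3 **`coeff_satakeTransform_comp_perm_of_units_unitary`** (THE THEOREM; the statement is in the `Valued` language — the
  auxiliary `ValuativeRel` structure needed by the Siegel descent is built inside the proof from `Valued.v`).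

## References
* [CartierCorvallis1979] P. Cartier, *Representations of 𝔭-adic groups: a survey*, PSPM 33.1 (1979), §IV Thm. 4.1 and its proof (b).
* [Satake1963] I. Satake, *Theory of spherical functions on reductive algebraic groups over 𝔭-adic fields*, Publ. Math. IHÉS 18
  (1963), §6, §8.
* [Minguez2011] A. Mínguez, *Unramified representations of unitary groups*, in: *On the stabilization of the trace formula* (2011), §4.
* [BruhatTits1972] F. Bruhat, J. Tits, *Groupes réductifs sur un corps local I*, Publ. Math. IHÉS 41 (1972), (4.4.3).
* [Macdonald1971] I. G. Macdonald, *Spherical functions on a group of p-adic type*, Madras (1971), Ch. IV, V.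
-/

noncomputable section

open scoped Valued WithZero Matrix MatrixGroups
open MonoidAlgebra Representation

namespace Literature.NumberTheory.Automorphic.HermitianLattice

open Literature.NumberTheory.Automorphic Literature.NumberTheory.Automorphic.CartanUnique

variable {K : Type*} [Field K] [Valued K ℤᵐ⁰] {σ : K →+* K} {ϖ : K} {M N : ℕ}

/-! ## §1 The centraliser of `rev` in `S_{M+2}`: reduction to the Klingen and Siegel types -/

section Combinatorics

/-- A `rev`-commuting permutation fixing `0` also fixes `M + 1 = rev 0`. [cite: BruhatTits1972, (4.4.3)] -/
theorem perm_last_of_zero {π : Equiv.Perm (Fin (M + 2))} (hπ : ∀ i, π (Fin.rev i) = Fin.rev (π i)) (h0 : π 0 = 0) :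
    π (Fin.last (M + 1)) = Fin.last (M + 1) := by
  rw [show Fin.last (M + 1) = Fin.rev (0 : Fin (M + 2)) from Fin.ext (by simp), hπ, h0]

/-- **A `rev`-commuting permutation fixing `0` is the extension `π̂'` of a `rev`-commuting permutation `π'` of the middle block.**
[cite: BruhatTits1972, (4.4.3)] -/
theorem exists_klingenExtend_eq {π : Equiv.Perm (Fin (M + 2))} (hπ : ∀ i, π (Fin.rev i) = Fin.rev (π i)) (h0 : π 0 = 0) :
    ∃ π' : Equiv.Perm (Fin M), (∀ j : Fin M, π' (Fin.rev j) = Fin.rev (π' j)) ∧ klingenExtend π' = π := by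
  have hl := perm_last_of_zero hπ h0
  have h0' : π.symm 0 = 0 := by rw [Equiv.symm_apply_eq]; exact h0.symm
  have hl' : π.symm (Fin.last (M + 1)) = Fin.last (M + 1) := by rw [Equiv.symm_apply_eq]; exact hl.symm
  -- the middle block is stable under `π` and `π⁻¹`
  have hmid : ∀ (ρ : Equiv.Perm (Fin (M + 2))), ρ 0 = 0 → ρ (Fin.last (M + 1)) = Fin.last (M + 1) →
      ∀ j : Fin (M + 2 - 2 * 1), 1 ≤ ((ρ (midIndex two_mul_one_le_add_two j) : Fin (M + 2)) : ℕ) ∧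
        ((ρ (midIndex two_mul_one_le_add_two j) : Fin (M + 2)) : ℕ) ≤ M := by
    intro ρ hρ0 hρl j
    have h1 : ρ (midIndex two_mul_one_le_add_two j) ≠ 0 := by
      rw [ne_eq, ← hρ0, ρ.injective.eq_iff]; intro h; have := congrArg Fin.val h; simp at this
    have h2 : ρ (midIndex two_mul_one_le_add_two j) ≠ Fin.last (M + 1) := by
      rw [ne_eq, ← hρl, ρ.injective.eq_iff]; intro h; have := congrArg Fin.val h; have hj := j.isLt; simp at this; omega
    rw [ne_eq, Fin.ext_iff] at h1 h2
    simp only [Fin.val_zero, Fin.val_last] at h1 h2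
    have := (ρ (midIndex two_mul_one_le_add_two j)).isLt
    omega
  let f : Fin (M + 2 - 2 * 1) → Fin (M + 2 - 2 * 1) := fun j =>
    ⟨((π (midIndex two_mul_one_le_add_two j) : Fin (M + 2)) : ℕ) - 1, by have := hmid π h0 hl j; omega⟩
  let g : Fin (M + 2 - 2 * 1) → Fin (M + 2 - 2 * 1) := fun j =>
    ⟨((π.symm (midIndex two_mul_one_le_add_two j) : Fin (M + 2)) : ℕ) - 1, by have := hmid π.symm h0' hl' j; omega⟩
  have hf : ∀ j, midIndex two_mul_one_le_add_two (f j) = π (midIndex two_mul_one_le_add_two j) := fun j => by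
    apply Fin.ext; have := hmid π h0 hl j; simp [f]; omega
  have hg : ∀ j, midIndex two_mul_one_le_add_two (g j) = π.symm (midIndex two_mul_one_le_add_two j) := fun j => by
    apply Fin.ext; have := hmid π.symm h0' hl' j; simp [g]; omega
  refine ⟨⟨f, g, fun j => ?_, fun j => ?_⟩, fun j => ?_, ?_⟩
  · apply midIndex_injective two_mul_one_le_add_two; rw [hg, hf, Equiv.symm_apply_apply]
  · apply midIndex_injective two_mul_one_le_add_two; rw [hf, hg, Equiv.apply_symm_apply]
  · apply midIndex_injective two_mul_one_le_add_two
    change midIndex _ (f (@Fin.rev (M + 2 - 2 * 1) j)) = midIndex _ (@Fin.rev (M + 2 - 2 * 1) (f j))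
    rw [hf, ← rev_midIndex, hπ, ← hf, rev_midIndex]
  · ext i : 1
    obtain ⟨x, rfl⟩ := (blockSum (two_mul_one_le_add_two (M := M))).surjective i
    rcases x with (j | j) | j
    · rw [blockSum_inl_inl, castLE_fin_one, klingenExtend_zero, h0]
    · rw [blockSum_inl_inr, klingenExtend_midIndex]; exact hf j
    · rw [blockSum_inr, hiIndex_fin_one, klingenExtend_last, hl]

/-- **`t_k = (0 k)(M+1, rev k)`**: the double transposition exchanging the coordinate pairs `{0, M+1}` and `{k, rev k}`.
[cite: BruhatTits1972, (4.4.3)] -/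
def swapPairZero (k : Fin (M + 2)) : Equiv.Perm (Fin (M + 2)) :=
  Equiv.swap 0 k * Equiv.swap (Fin.last (M + 1)) (Fin.rev k)

/-- The values of `t_k` (`0 < k < ⌊(M+2)/2⌋`): `0 ↦ k ↦ 0`, `M+1 ↦ rev k ↦ M+1`, the rest fixed. [cite: BruhatTits1972, (4.4.3)] -/
theorem swapPairZero_val {k : Fin (M + 2)} (hk0 : 0 < (k : ℕ)) (hkn : (k : ℕ) < (M + 2) / 2) (i : Fin (M + 2)) :
    ((swapPairZero k i : Fin (M + 2)) : ℕ) =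
      if (i : ℕ) = M + 1 then M + 1 - (k : ℕ) else if (i : ℕ) = M + 1 - (k : ℕ) then M + 1
      else if (i : ℕ) = 0 then (k : ℕ) else if (i : ℕ) = (k : ℕ) then 0 else (i : ℕ) := by
  have hk := k.isLt
  have hi := i.isLt
  have hA : Fin.rev k ≠ (0 : Fin (M + 2)) := by rw [ne_eq, Fin.ext_iff, Fin.val_rev, Fin.val_zero]; omega
  have hB : Fin.rev k ≠ k := by rw [ne_eq, Fin.ext_iff, Fin.val_rev]; omega
  have hC : Fin.last (M + 1) ≠ (0 : Fin (M + 2)) := by rw [ne_eq, Fin.ext_iff, Fin.val_last, Fin.val_zero]; omega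
  have hD : Fin.last (M + 1) ≠ k := by rw [ne_eq, Fin.ext_iff, Fin.val_last]; omega
  rw [swapPairZero, Equiv.Perm.mul_apply]
  rcases eq_or_ne i (Fin.last (M + 1)) with h1 | h1
  · rw [h1, Equiv.swap_apply_left, Equiv.swap_apply_of_ne_of_ne hA hB, Fin.val_rev, Fin.val_last, if_pos rfl]
    omega
  rcases eq_or_ne i (Fin.rev k) with h2 | h2
  · rw [h2, Equiv.swap_apply_right, Equiv.swap_apply_of_ne_of_ne hC hD, Fin.val_last, Fin.val_rev]
    have h1' : ¬ (M + 2 - ((k : ℕ) + 1) = M + 1) := fun h => h1 (by rw [h2]; apply Fin.ext; rw [Fin.val_rev, Fin.val_last]; omega)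
    rw [if_neg h1', if_pos (by omega)]
  rw [Equiv.swap_apply_of_ne_of_ne h1 h2, Equiv.swap_apply_def]
  have h1' : ¬ ((i : ℕ) = M + 1) := fun h => h1 (Fin.ext (by rw [Fin.val_last]; exact h))
  have h2' : ¬ ((i : ℕ) = M + 1 - (k : ℕ)) := fun h => h2 (Fin.ext (by rw [Fin.val_rev]; omega))
  rw [if_neg h1', if_neg h2']
  by_cases h3 : i = 0
  · rw [if_pos h3, if_pos (by rw [h3, Fin.val_zero])]
  · have h3' : ¬ ((i : ℕ) = 0) := fun h => h3 (Fin.ext (by rw [Fin.val_zero]; exact h))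
    rw [if_neg h3, if_neg h3']
    by_cases h4 : i = k
    · rw [if_pos h4, if_pos (congrArg Fin.val h4), Fin.val_zero]
    · rw [if_neg h4, if_neg (fun h => h4 (Fin.ext h))]

/-- `t_k(k) = 0` for `0 < k < ⌊(M+2)/2⌋`. [cite: BruhatTits1972, (4.4.3)] -/
theorem swapPairZero_apply_self {k : Fin (M + 2)} (hk0 : 0 < (k : ℕ)) (hkn : (k : ℕ) < (M + 2) / 2) : swapPairZero k k = 0 := by
  apply Fin.ext
  rw [swapPairZero_val hk0 hkn, Fin.val_zero]
  have hk := k.isLt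
  split_ifs <;> omega

/-- `t_k` commutes with `rev` (`0 < k < ⌊(M+2)/2⌋`). [cite: BruhatTits1972, (4.4.3)] -/
theorem swapPairZero_rev {k : Fin (M + 2)} (hk0 : 0 < (k : ℕ)) (hkn : (k : ℕ) < (M + 2) / 2) (i : Fin (M + 2)) :
    swapPairZero k (Fin.rev i) = Fin.rev (swapPairZero k i) := by
  apply Fin.ext
  rw [swapPairZero_val hk0 hkn, Fin.val_rev, Fin.val_rev, swapPairZero_val hk0 hkn]
  have hk := k.isLt; have hi := i.isLt
  split_ifs <;> omega

/-- `t_k` preserves the first coordinate block (`0 < k < ⌊(M+2)/2⌋`). [cite: BruhatTits1972, (4.4.3)] -/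
theorem swapPairZero_lt_iff {k : Fin (M + 2)} (hk0 : 0 < (k : ℕ)) (hkn : (k : ℕ) < (M + 2) / 2) (i : Fin (M + 2)) :
    ((swapPairZero k i : Fin (M + 2)) : ℕ) < (M + 2) / 2 ↔ (i : ℕ) < (M + 2) / 2 := by
  rw [swapPairZero_val hk0 hkn]
  have hk := k.isLt; have hi := i.isLt
  split_ifs <;> omega

/-- For a `rev`-commuting `π` of `Fin (M + 2)`, `π(0)` is not the middle index: `π(0) < n` or `rev (π 0) < n`, `n = ⌊(M+2)/2⌋`.
[cite: BruhatTits1972, (4.4.3)] -/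
theorem perm_zero_lt_or_rev_lt {π : Equiv.Perm (Fin (M + 2))} (hπ : ∀ i, π (Fin.rev i) = Fin.rev (π i)) :
    ((π 0 : Fin (M + 2)) : ℕ) < (M + 2) / 2 ∨ ((Fin.rev (π 0) : Fin (M + 2)) : ℕ) < (M + 2) / 2 := by
  by_contra h
  rw [not_or, not_lt, not_lt, Fin.val_rev] at h
  have hfix : Fin.rev (π 0) = π 0 := by apply Fin.ext; rw [Fin.val_rev]; omega
  rw [← hπ, π.injective.eq_iff, Fin.ext_iff, Fin.val_rev, Fin.val_zero] at hfix
  omega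

/-- The inverse of a `rev`-commuting permutation commutes with `rev`. [cite: BruhatTits1972, (4.4.3)] -/
theorem perm_inv_rev {π : Equiv.Perm (Fin N)} (hπ : ∀ i, π (Fin.rev i) = Fin.rev (π i)) (i : Fin N) :
    π⁻¹ (Fin.rev i) = Fin.rev (π⁻¹ i) := by
  rw [Equiv.Perm.inv_def, Equiv.symm_apply_eq, hπ, Equiv.apply_symm_apply]

/-- The inverse of a first-block-preserving permutation preserves the first block. [cite: BruhatTits1972, (4.4.3)] -/
theorem perm_inv_lt_iff {π : Equiv.Perm (Fin N)} (hπ : ∀ i : Fin N, ((π i : ℕ) < N / 2 ↔ (i : ℕ) < N / 2)) (i : Fin N) :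
    ((π⁻¹ i : ℕ) < N / 2 ↔ (i : ℕ) < N / 2) := by
  have h := hπ (π⁻¹ i)
  rw [Equiv.Perm.inv_def, Equiv.apply_symm_apply] at h
  rw [Equiv.Perm.inv_def]
  exact h.symm

/-- Composition of `rev`-commuting permutations. [cite: BruhatTits1972, (4.4.3)] -/
theorem perm_mul_rev {π ρ : Equiv.Perm (Fin N)} (hπ : ∀ i, π (Fin.rev i) = Fin.rev (π i)) (hρ : ∀ i, ρ (Fin.rev i) = Fin.rev (ρ i))
    (i : Fin N) : (π * ρ) (Fin.rev i) = Fin.rev ((π * ρ) i) := by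
  rw [Equiv.Perm.mul_apply, Equiv.Perm.mul_apply, hρ, hπ]

/-- `rev` itself, as the permutation `Fin.revPerm`, commutes with `rev`. [cite: BruhatTits1972, (4.4.3)] -/
theorem revPerm_rev (i : Fin N) : Fin.revPerm (Fin.rev i) = Fin.rev (Fin.revPerm i) := by
  rw [Fin.revPerm_apply, Fin.revPerm_apply]

end Combinatorics

/-! ## §2 Weights through `κ₀`, and the `rev`-invariance in every rank -/

section Weights

variable {R : Type*} [CommRing R]

/-- `⟨ν_{M+2}, κ(0, λ)⟩ = ⟨ν_M, λ⟩ + |λ|`, in the block typing `Fin (M + 2 - 2·1)` of `HyperspecialUnitaryParabolicBlocks`.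
[cite: CartierCorvallis1979, §IV (4.2)] -/
theorem satakeTwistExp_klingenExp_zero (la : Fin (M + 2 - 2 * 1) → ℤ) :
    satakeTwistExp (klingenExp M 0 la) = satakeTwistExp la + ∑ j, la j := by
  rw [satakeTwistExp, satakeTwistExp, sum_eq_sum_blocks (two_mul_one_le_add_two (M := M))]
  simp only [castLE_fin_one, klingenExp_zero, mul_zero, Finset.sum_const_zero, zero_add, hiIndex_fin_one, klingenExp_last,
    neg_zero, add_zero, klingenExp_midIndex, coe_midIndex]
  rw [← Finset.sum_add_distrib]
  refine Finset.sum_congr rfl fun j _ => ?_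
  have hc : (((M + 2 - 2 * 1 : ℕ)) : ℤ) = (M : ℤ) := by norm_num
  rw [hc]; push_cast; ring

/-- **`⟨ν_{M+2}, κ₀ λ⟩ = ⟨ν_M, λ⟩ + |λ|`** for `λ ∈ ℤ^M` (`ν_m = (m-1, …, 1, 0)`, `κ₀ λ = (0, λ, 0)`). [cite: CartierCorvallis1979, §IV (4.2)] -/
theorem satakeTwistExp_klingenMidHom (la : Fin M → ℤ) :
    satakeTwistExp (klingenMidHom M la) = satakeTwistExp la + ∑ j, la j :=
  satakeTwistExp_klingenExp_zero la

/-- The weight `λ ↦ u^{-(⟨ν_M, λ⟩ + |λ|)}` (`= w ∘ κ₀` for `w = u^{-⟨ν_{M+2}, ·⟩}`) exists as a character of `ℤ^M`.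
[cite: CartierCorvallis1979, §IV (4.2)] -/
theorem exists_monoidHom_klingenWeight (u : Rˣ) :
    ∃ w' : Multiplicative (Fin M → ℤ) →* R,
      ∀ e : Fin M → ℤ, w' (Multiplicative.ofAdd e) = ((u ^ (-(satakeTwistExp e + ∑ j, e j)) : Rˣ) : R) := by
  obtain ⟨w', hw'⟩ := exists_monoidHom_apply_ofAdd_eq_units_zpow (Λ := Fin M → ℤ) u
    (-(AddMonoidHom.mk' (fun e : Fin M → ℤ => satakeTwistExp e + ∑ j, e j) fun a b => by
      simp only [satakeTwistExp_add, Pi.add_apply, Finset.sum_add_distrib]; ring))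
  exact ⟨w', fun e => by rw [hw']; rfl⟩

/-- **`w ∘ κ₀ = u^{-(⟨ν_M, ·⟩ + |·|)}`** for `w = u^{-⟨ν_{M+2}, ·⟩}`, as characters of `ℤ^M`. [cite: CartierCorvallis1979, §IV (4.2)] -/
theorem comp_klingenMidHom_eq {u : Rˣ} {w : Multiplicative (Fin (M + 2) → ℤ) →* R}
    (hw : ∀ e : Fin (M + 2) → ℤ, w (Multiplicative.ofAdd e) = ((u ^ (-satakeTwistExp e) : Rˣ) : R))
    {w' : Multiplicative (Fin M → ℤ) →* R}
    (hw' : ∀ e : Fin M → ℤ, w' (Multiplicative.ofAdd e) = ((u ^ (-(satakeTwistExp e + ∑ j, e j)) : Rˣ) : R)) :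
    (w.comp (AddMonoidHom.toMultiplicative (klingenMidHom M)) : Multiplicative (Fin M → ℤ) →* R) = w' := by
  refine MonoidHom.ext fun x => ?_
  show w (Multiplicative.ofAdd (klingenMidHom M (Multiplicative.toAdd x : Fin M → ℤ))) =
    w' (Multiplicative.ofAdd (Multiplicative.toAdd x))
  rw [hw, satakeTwistExp_klingenMidHom, hw']

namespace UnramifiedLocalConjDatum

/-- The coefficients of `𝒮_w(T)` are `w` times those of the counting transform `𝒮_1(T)`. [cite: CartierCorvallis1979, §IV (4.2)] -/
theorem coeff_satakeTransform_eq_weight_mul (hd : UnramifiedLocalConjDatum σ ϖ) [Finite 𝓀[K]] (w : Multiplicative (Fin N → ℤ) →* R)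
    (T : heckeAlgebra R (unitaryGroupOfForm σ ((StdForm.antidiagonal N).over K)) (unitaryInt σ ((StdForm.antidiagonal N).over K)))
    (μ : Fin N → ℤ) :
    ((hd.isIwasawaExponent (N := N)).satakeTransform w T).coeff μ =
      w (Multiplicative.ofAdd μ) * ((hd.isIwasawaExponent (N := N)).satakeTransform 1 T).coeff μ := by
  haveI := isHeckeTriple_unitaryInt_of_finite_residueField hd.vϖ σ ((StdForm.antidiagonal N).over K)
  rw [IsIwasawaExponent.satakeTransform_apply, IsIwasawaExponent.satakeTransform_apply, ← monomialTwist_satakeVec,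
    coeff_monomialTwist]

/-- **`rev`-invariance in every rank**: `𝒮_w(T)_{μ ∘ rev} = 𝒮_w(T)_μ` (`w(e) = u^{-⟨ν,e⟩}`, `(u : R) = q_F`), from the
`w₀ = -1` symmetry `𝒮_w(T)_{-μ} = 𝒮_w(T)_μ` and the support condition `μ ∘ rev = -μ`.
[cite: CartierCorvallis1979, §IV Thm. 4.1] [cite: Minguez2011, §4] -/
theorem coeff_satakeTransform_comp_rev_of_units_unitary (hd : UnramifiedLocalConjDatum σ ϖ) [Finite 𝓀[K]]
    (hσ : ∃ x : K, σ x ≠ x) (u : Rˣ) (hu : (u : R) = Nat.sqrt (Nat.card 𝓀[K])) (w : Multiplicative (Fin N → ℤ) →* R)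
    (hw : ∀ e : Fin N → ℤ, w (Multiplicative.ofAdd e) = ((u ^ (-satakeTwistExp e) : Rˣ) : R))
    (T : heckeAlgebra R (unitaryGroupOfForm σ ((StdForm.antidiagonal N).over K)) (unitaryInt σ ((StdForm.antidiagonal N).over K)))
    (μ : Fin N → ℤ) :
    ((hd.isIwasawaExponent (N := N)).satakeTransform w T).coeff (μ ∘ Fin.rev) =
      ((hd.isIwasawaExponent (N := N)).satakeTransform w T).coeff μ := by
  haveI := isHeckeTriple_unitaryInt_of_finite_residueField hd.vϖ σ ((StdForm.antidiagonal N).over K)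
  by_cases hμ : ∀ i, μ (Fin.rev i) = -μ i
  · rw [show μ ∘ Fin.rev = -μ from funext fun i => hμ i]
    exact hd.coeff_satakeTransform_neg_of_units_unitary hσ u hu w hw T μ
  · have hμ' : ¬ ∀ i, (μ ∘ Fin.rev) (Fin.rev i) = -(μ ∘ Fin.rev) i := fun h => hμ fun i => by
      have := h (Fin.rev i); simp only [Function.comp_apply, Fin.rev_rev] at this; omega
    rw [hd.coeff_satakeTransform_eq_zero_of_not_rev w T hμ, hd.coeff_satakeTransform_eq_zero_of_not_rev w T hμ']

end UnramifiedLocalConjDatum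

end Weights

/-! ## §3 The theorem -/

section Main

variable {R : Type*} [CommRing R]

namespace UnramifiedLocalConjDatum

/-- **WEYL-GROUP INVARIANCE OF THE SATAKE TRANSFORM OF `U(σ, J₀)` IN EVERY RANK** (Satake; Cartier Thm. 4.1 (b)): for an unramified
conjugation datum with `σ ≠ id` and finite residue field (`q = q_F²`), every commutative ring `R`, every unit `u` of `R` with
`(u : R) = q_F`, the weight `w(e) = u^{-⟨ν, e⟩}` (`= δ_B^{1/2}` on cocharacters), every `T ∈ ℋ_R(U(σ, J₀^{(N)}), K₀)`, every
permutation `π` of `Fin N` commuting with `rev` (an element of the Weyl group `W = (ℤ/2)^{⌊N/2⌋} ⋊ S_{⌊N/2⌋}`) and every `μ`: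
`𝒮_w(T)_{μ ∘ π} = 𝒮_w(T)_μ`. [cite: CartierCorvallis1979, §IV Thm. 4.1 and its proof (b)] [cite: Satake1963, §6] [cite: Minguez2011, §4] -/
theorem coeff_satakeTransform_comp_perm_of_units_unitary (hd : UnramifiedLocalConjDatum σ ϖ) [Finite 𝓀[K]]
    (hσ : ∃ x : K, σ x ≠ x) (u : Rˣ) (hu : (u : R) = Nat.sqrt (Nat.card 𝓀[K])) :
    ∀ (N : ℕ) (w : Multiplicative (Fin N → ℤ) →* R)
      (_hw : ∀ e : Fin N → ℤ, w (Multiplicative.ofAdd e) = ((u ^ (-satakeTwistExp e) : Rˣ) : R))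
      (T : heckeAlgebra R (unitaryGroupOfForm σ ((StdForm.antidiagonal N).over K)) (unitaryInt σ ((StdForm.antidiagonal N).over K)))
      (π : Equiv.Perm (Fin N)) (_hπ : ∀ i, π (Fin.rev i) = Fin.rev (π i)) (μ : Fin N → ℤ),
      ((hd.isIwasawaExponent (N := N)).satakeTransform w T).coeff (μ ∘ π) =
        ((hd.isIwasawaExponent (N := N)).satakeTransform w T).coeff μ := by
  have hu2 : (u : R) ^ 2 = ((Nat.card 𝓀[K] : ℕ) : R) := by
    rw [hu, sq, ← Nat.cast_mul, hd.sqrt_card_residueField_mul_self hσ]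
  letI := ValuativeRel.ofValuation (Valued.v : Valuation K ℤᵐ⁰)
  haveI : (Valued.v : Valuation K ℤᵐ⁰).Compatible := Valuation.Compatible.ofValuation _
  intro N
  induction N using Nat.strong_induction_on with
  | _ N ih =>
  match N, ih with
  | 0, _ =>
    intro w hw T π hπ μ
    rw [show π = 1 from Equiv.ext fun i => Subsingleton.elim _ _, Equiv.Perm.coe_one, Function.comp_id]
  | 1, _ =>
    intro w hw T π hπ μ
    rw [show π = 1 from Equiv.ext fun i => Subsingleton.elim _ _, Equiv.Perm.coe_one, Function.comp_id]
  | M + 2, ih =>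
    intro w hw T π hπ μ
    /- rank `M + 2`; the induction hypothesis for `U_M` in the weight `w_M = u^{-⟨ν_M, ·⟩}` -/
    obtain ⟨wM, hwM⟩ := UnramifiedLocalConjDatum.exists_weight_units_zpow_neg_satakeTwistExp (N := M) (R := R) u
    have ihM := ih M (by omega) wM hwM
    -- the weight `w ∘ κ₀ = u^{-(⟨ν_M, ·⟩ + |·|)}` of `U_M`
    obtain ⟨w', hw'⟩ := exists_monoidHom_klingenWeight (M := M) (R := R) u
    have heq := comp_klingenMidHom_eq hw hw'
    have e1 : ∀ e : Fin M → ℤ, ((u ^ (-(satakeTwistExp e + ∑ j, e j)) : Rˣ) : R) =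
        ((u ^ (-∑ j, e j) : Rˣ) : R) * ((u ^ (-satakeTwistExp e) : Rˣ) : R) := fun e => by
      rw [← Units.val_mul, ← zpow_add]; congr 2; ring
    -- (i) KLINGEN: invariance under every `rev`-commuting `ρ` fixing `0`
    have stepK : ∀ (ρ : Equiv.Perm (Fin (M + 2))), (∀ i, ρ (Fin.rev i) = Fin.rev (ρ i)) → ρ 0 = 0 →
        ∀ ν : Fin (M + 2) → ℤ, ((hd.isIwasawaExponent (N := M + 2)).satakeTransform w T).coeff (ν ∘ ρ) =
          ((hd.isIwasawaExponent (N := M + 2)).satakeTransform w T).coeff ν := by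
      intro ρ hρ hρ0 ν
      obtain ⟨π', hπ', hext⟩ := exists_klingenExtend_eq hρ hρ0
      rw [← hext]
      refine hd.coeff_satakeTransform_comp_klingenExtend w π' (fun T' la => ?_) T ν
      rw [heq]
      have key := ihM T' π' hπ' la
      rw [hd.coeff_satakeTransform_eq_weight_mul, hd.coeff_satakeTransform_eq_weight_mul _ _ la, hwM, hwM] at key
      rw [hd.coeff_satakeTransform_eq_weight_mul, hd.coeff_satakeTransform_eq_weight_mul _ _ la, hw', hw', e1, e1,
        show (∑ j, (la ∘ ⇑π') j) = ∑ j, la j from Equiv.sum_comp π' la, mul_assoc, mul_assoc, key]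
    -- (ii) SIEGEL + KLINGEN: invariance under every `rev`-commuting `ρ` with `ρ(0)` in the first block
    have stepS : ∀ (ρ : Equiv.Perm (Fin (M + 2))), (∀ i, ρ (Fin.rev i) = Fin.rev (ρ i)) → ((ρ 0 : Fin (M + 2)) : ℕ) < (M + 2) / 2 →
        ∀ ν : Fin (M + 2) → ℤ, ((hd.isIwasawaExponent (N := M + 2)).satakeTransform w T).coeff (ν ∘ ρ) =
          ((hd.isIwasawaExponent (N := M + 2)).satakeTransform w T).coeff ν := by
      intro ρ hρ hρ0 ν
      by_cases h0 : ((ρ 0 : Fin (M + 2)) : ℕ) = 0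
      · exact stepK ρ hρ (Fin.ext h0) ν
      · -- `t = (0 k)(M+1, rev k)`, `k = ρ 0`; `t ρ` fixes `0`
        have hk0 : 0 < ((ρ 0 : Fin (M + 2)) : ℕ) := Nat.pos_of_ne_zero h0
        have htrev : ∀ i, swapPairZero (ρ 0) (Fin.rev i) = Fin.rev (swapPairZero (ρ 0) i) := swapPairZero_rev hk0 hρ0
        have htlt : ∀ i : Fin (M + 2), ((swapPairZero (ρ 0) i : ℕ) < (M + 2) / 2 ↔ (i : ℕ) < (M + 2) / 2) :=
          swapPairZero_lt_iff hk0 hρ0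
        have hfix : (swapPairZero (ρ 0) * ρ) 0 = 0 := by rw [Equiv.Perm.mul_apply, swapPairZero_apply_self hk0 hρ0]
        have h1 := stepK (swapPairZero (ρ 0) * ρ) (perm_mul_rev htrev hρ) hfix (ν ∘ ⇑(swapPairZero (ρ 0))⁻¹)
        rw [show (ν ∘ ⇑(swapPairZero (ρ 0))⁻¹) ∘ ⇑(swapPairZero (ρ 0) * ρ) = ν ∘ ρ by
          rw [Function.comp_assoc, ← Equiv.Perm.coe_mul, ← mul_assoc, inv_mul_cancel, one_mul]] at h1
        rw [h1]
        exact hd.coeff_satakeTransform_comp_perm_siegel u hu2 w hw T (perm_inv_rev htrev) (perm_inv_lt_iff htlt) ν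
    -- (iii) the general case: `π(0)` or `rev (π 0)` lies in the first block
    rcases perm_zero_lt_or_rev_lt hπ with hlt | hlt
    · exact stepS π hπ hlt μ
    · have hρrev : ∀ i, ((Fin.revPerm : Equiv.Perm (Fin (M + 2))) * π) (Fin.rev i) =
          Fin.rev (((Fin.revPerm : Equiv.Perm (Fin (M + 2))) * π) i) := perm_mul_rev revPerm_rev hπ
      have h1 := stepS ((Fin.revPerm : Equiv.Perm (Fin (M + 2))) * π) hρrev
        (by rwa [Equiv.Perm.mul_apply, Fin.revPerm_apply]) (μ ∘ Fin.rev)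
      rw [show (μ ∘ Fin.rev) ∘ ⇑((Fin.revPerm : Equiv.Perm (Fin (M + 2))) * π) = μ ∘ π by
        funext i; simp only [Function.comp_apply, Equiv.Perm.mul_apply, Fin.revPerm_apply, Fin.rev_rev]] at h1
      rw [h1]
      exact hd.coeff_satakeTransform_comp_rev_of_units_unitary hσ u hu w hw T μ

end UnramifiedLocalConjDatum

end Main

end Literature.NumberTheory.Automorphic.HermitianLattice

end
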